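import Literature.MathematicalPhysics.QuantumFieldTheory.Balaban1983to89.B9Ineq366L2
import Literature.MathematicalPhysics.QuantumFieldTheory.Balaban1983to89.B6RandomWalkL2Hom

/-!
# `Balaban1983to89.B9Ineq349L2Readings` — B9 p. 399 (3.49) IN BLOCK-`ℓ²` FROM THE READINGS OF `Q′`, `Q′*` AND THE (3.48) ENTRY BOUND OF
# `C⁻¹ = (Q′G′²Q′*)⁻¹` ON THE LATTICE OF BLOCKS

The four block-`ℓ²` (3.49) entries of the word `G·(Q′*·C⁻¹·Q′)·G` of `R(U) = G(U)Q′*C⁻¹Q′G(U)` ((3.25)/(3.48)–(3.49)) — `GMG`, `∇·GMG`,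
`GMG·∇*`, `∇·GMG·∇*` with `M := Q′* ∘ C⁻¹ ∘ Q′` — from

* the STRUCTURED block-`ℓ²` readings of the averaging letters (`B6RandomWalkL2Hom.HasL2MajorantHom`): `Q′ : X → 𝔅` with the diagonal
  Hom-majorant `κ_c·w_c(y)𝟙[y = y′]` and `Q′* : 𝔅 → X` with `κ_s·w_s(y)𝟙[y = y′]`, `w_s·w_c ≦ 1` (at an instance `w_c = (#Δ)^{−1/2}`,
  `w_s = (#Δ)^{1/2}`), and the p. 398 transfer of `w_c` at `(δ_C, α_C)` with constant `Λ_C` (the volume-ratio transfer);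
* the (3.48) ENTRY bound of `C⁻¹` on 𝔅: `|C⁻¹(y, y′)| ≦ B_C (Lʲη)⁻⁴ e^{−δ_C d(y,y′)}` (Theorem 3.2 / (3.48), a bound on matrix entries w.r.t. the
  counting measure on 𝔅 — in block-`ℓ²` on 𝔅 it IS the majorant, `B6RandomWalkL2Hom.hasL2Majorant_sites_of_entry`);
* Theorem 3.3's block-`ℓ²` members `G ≺₂ B₀(Lʲη)²e^{−δd}`, `∇G, G∇* ≺₂ B₀Lʲη e^{−δd}` and the located devices' geometry,

by `B6RandomWalkL2Hom.hasL2Majorant_sandwich` (§1: `M ≺₂ κ_sκ_cB_CΛ_C (Lʲη)⁻⁴ e^{−(1−α_C)δ_C d}`, then the rate is lowered to the common `δ`) and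
`B9Ineq366L2.ineq349_l2_sandwich` (§2).  This is the discharge pattern of the `(3.49)`-shaped hypotheses `hP`, `hDP`, `hPDs` of `B9Ineq377L2Hom.
ineq377_l2_concreteE` from READINGS (successor item A of the seat's `GSIDE-L2-SPEC.md` v3).

HONEST SCOPE.  Finite-dimensional bookkeeping; `Q′`, `Q′*`, `C⁻¹`, `G`, `∇`, `∇*` are letters with their readings as hypotheses; nothing of [B9] is
asserted for Bałaban's operators; count-neutral; NOT a node discharge; nothing continuum ∕ OS ∕ mass-gap ∕ Clay.  Cell `pub-ymgap` (HUMAN RULING D-0062),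
Track A node N06 [B9], N06-ASSIGNMENT row 13 (G-side `ℓ²` route), seat `pub-ymgap-dag-n06-c` (g5), 2026-08-27.
-/

noncomputable section

open scoped BigOperators

namespace Literature.MathematicalPhysics.QuantumFieldTheory.Balaban1983to89.B9Ineq349L2Readings

open Literature.MathematicalPhysics.QuantumFieldTheory.Balaban1983to89
open Literature.MathematicalPhysics.QuantumFieldTheory.Balaban1983to89.B6RandomWalk (Triangle254 Ineq261)
open Literature.MathematicalPhysics.QuantumFieldTheory.Balaban1983to89.B6RandomWalkL2 (HasL2Majorant hasL2Majorant_mono)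
open Literature.MathematicalPhysics.QuantumFieldTheory.Balaban1983to89.B6RandomWalkL2Hom (HasL2MajorantHom hasL2Majorant_sandwich
  hasL2Majorant_sites_of_entry)
open Literature.MathematicalPhysics.QuantumFieldTheory.Balaban1983to89.B9Thm34Ext (toB6)
open Literature.MathematicalPhysics.QuantumFieldTheory.Balaban1983to89.B9Ineq347 (ScaleTransfer)
open Literature.MathematicalPhysics.QuantumFieldTheory.Balaban1983to89.B9Ineq363L2 (hasL2Majorant_rate_mono)
open Literature.MathematicalPhysics.QuantumFieldTheory.Balaban1983to89.B9Ineq366L2 (ineq349_l2_sandwich)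

variable {g : B9.Geometry} [Fintype g.Site] [DecidableEq g.Site] {R : ℝ} {H : Prop} {W : Type} [Fintype W]

/-! ## §1  `M = Q′*·C⁻¹·Q′` in block-`ℓ²` from the readings -/

/-- ★ **`Q′*·C⁻¹·Q′ ≺₂ κ_sκ_cB_CΛ_C·(Lʲη)⁻⁴·e^{−δd}` FROM THE READINGS**: the structured block-`ℓ²` readings of `Q′`, `Q′*` (diagonal Hom-majorants with
weights `w_c`, `w_s`, `w_s·w_c ≦ 1`), the (3.48) entry bound of `C⁻¹` on 𝔅 at a rate `δ_C`, the transfer of `w_c` at `(δ_C, α_C)` and `δ ≦ (1−α_C)δ_C`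
give the block-`ℓ²` majorant of the sandwiched word on the fine carrier at the rate `δ` (`hasL2Majorant_sites_of_entry` + `hasL2Majorant_sandwich` +
`hasL2Majorant_rate_mono`). [cite: Balaban1985BackgroundPropagators, (3.25) p.394 + (3.48) p.398 + p.398 (remark after (3.47)); Balaban1984PropagatorsII, (2.52)–(2.55) p.232 + (2.140)–(2.141) p.247] -/
theorem hasL2Majorant_QcsCQc_of_readings (blk : W → g.Site) (δ δC αC ΛC κc κs BC : ℝ) (wc ws : g.Site → ℝ)
    (hκc : 0 ≤ κc) (hκs : 0 ≤ κs) (hBC : 0 ≤ BC) (hΛC : 0 ≤ ΛC) (hws : ∀ a, 0 ≤ ws a) (hprod : ∀ a, ws a * wc a ≤ 1)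
    (hδ : δ ≤ (1 - αC) * δC) (hdnn : ∀ a b : g.Site, 0 ≤ g.dist a b)
    (hTC : ∀ a b : g.Site, Real.exp (-(αC * δC * g.dist a b)) * wc b ≤ ΛC * wc a)
    {Qc : (W → ℝ) →ₗ[ℝ] (g.Site → ℝ)} {Cop : Module.End ℝ (g.Site → ℝ)} {Qcs : (g.Site → ℝ) →ₗ[ℝ] (W → ℝ)}
    (hQc : HasL2MajorantHom (g := toB6 g R H) blk (fun z : g.Site => z) Qc (fun a b : g.Site => if a = b then κc * wc a else 0))
    (hQcs : HasL2MajorantHom (g := toB6 g R H) (fun z : g.Site => z) blk Qcs (fun a b : g.Site => if a = b then κs * ws a else 0))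
    (h348 : ∀ y y' : g.Site, |Cop (Pi.single y' 1) y| ≤ BC * (g.len y ^ 4)⁻¹ * Real.exp (-(δC * g.dist y y'))) :
    HasL2Majorant (g := toB6 g R H) blk (Qcs ∘ₗ Cop ∘ₗ Qc)
      (fun a b => κs * κc * BC * ΛC * (g.len a ^ 4)⁻¹ * Real.exp (-(δ * g.dist a b))) := by
  letI : DecidableEq (toB6 g R H).Site := ‹DecidableEq g.Site›
  have hv : ∀ a : g.Site, 0 ≤ (g.len a ^ 4)⁻¹ := fun a => inv_nonneg.mpr (by positivity)
  have hL : HasL2Majorant (g := toB6 g R H) (fun z : g.Site => z) Cop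
      (fun a b => BC * (g.len a ^ 4)⁻¹ * Real.exp (-(δC * g.dist a b))) :=
    hasL2Majorant_sites_of_entry (g := toB6 g R H) h348
  have hS := hasL2Majorant_sandwich (g := toB6 g R H) blk δC αC ΛC κc κs BC wc ws (fun a => (g.len a ^ 4)⁻¹) hκc hκs hBC hΛC
    hws hv hprod hTC hQc hL hQcs
  have hA : 0 ≤ κs * κc * BC * ΛC := by positivity
  exact hasL2Majorant_rate_mono (R := R) (H := H) blk (κs * κc * BC * ΛC) (fun a => (g.len a ^ 4)⁻¹) hA hv hδ hdnn hS

/-! ## §2  The four (3.49) entries from the readings -/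

/-- ★★ **(3.49) IN BLOCK-`ℓ²` FROM THE READINGS OF `Q′`, `Q′*`, THE (3.48) ENTRY BOUND OF `C⁻¹` AND THEOREM 3.3's `ℓ²` MEMBERS OF `G(U)`**: with
`M := Q′*∘C⁻¹∘Q′` bounded by §1 (`B_M = κ_sκ_cB_CΛ_C`), `B9Ineq366L2.ineq349_l2_sandwich` gives the four entries
`GMG ≺₂ κ₃₄₉e^{−ρd}`, `∇GMG, GMG∇* ≺₂ κ₃₄₉(Lʲη)⁻¹e^{−ρd}`, `∇GMG∇* ≺₂ κ₃₄₉(Lʲη)⁻²e^{−ρd}`, `κ₃₄₉ = B9Ineq368PPrime.kappa349 1 B₀ B_M Λ c₁(β)`,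
for `ρ + (2α+β)δ₀ ≦ δ ≦ (1−α_C)δ_C` — i.e. the (3.49)-shaped inputs of the `P₁`/(3.77) bricks for the word `R(U) = GMG` with every letter a READING.
[cite: Balaban1985BackgroundPropagators, (3.25) p.394 + (3.48)–(3.49) pp.398–399 + (3.42) p.397; Balaban1984PropagatorsII, Lemma 2.1 p.234 + (2.52)–(2.55) p.232 + (2.140)–(2.141) p.247] -/
theorem ineq349_l2_of_readings (blk : W → g.Site) (d : ℕ) (δ₀ δ α β ρ Λ B₀ δC αC ΛC κc κs BC : ℝ) (wc ws : g.Site → ℝ)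
    (hB₀ : 0 ≤ B₀) (hΛ : 1 ≤ Λ) (hρ : 0 ≤ ρ) (hα : 0 ≤ α) (hβ : 0 ≤ β) (hδ₀ : 0 ≤ δ₀) (hr : ρ + (2 * α + β) * δ₀ ≤ δ)
    (hκc : 0 ≤ κc) (hκs : 0 ≤ κs) (hBC : 0 ≤ BC) (hΛC : 0 ≤ ΛC) (hws : ∀ a, 0 ≤ ws a) (hprod : ∀ a, ws a * wc a ≤ 1)
    (hδC : δ ≤ (1 - αC) * δC)
    (hdnn : ∀ a b : g.Site, 0 ≤ g.dist a b) (htri : Triangle254 (toB6 g R H)) (hlen : ∀ y : g.Site, 0 < g.len y)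
    (h261 : Ineq261 d (toB6 g R H) δ₀ β)
    (hT1 : ScaleTransfer g δ₀ α Λ (fun a => g.len a)) (hT2 : ScaleTransfer g δ₀ α Λ (fun a => g.len a ^ 2))
    (hT4 : ScaleTransfer g δ₀ α Λ (fun a => (g.len a ^ 4)⁻¹))
    (hTC : ∀ a b : g.Site, Real.exp (-(αC * δC * g.dist a b)) * wc b ≤ ΛC * wc a)
    {G D Ds : Module.End ℝ (W → ℝ)}
    {Qc : (W → ℝ) →ₗ[ℝ] (g.Site → ℝ)} {Cop : Module.End ℝ (g.Site → ℝ)} {Qcs : (g.Site → ℝ) →ₗ[ℝ] (W → ℝ)}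
    (hG : HasL2Majorant (g := toB6 g R H) blk G (fun a b => B₀ * g.len a ^ 2 * Real.exp (-(δ * g.dist a b))))
    (hDG : HasL2Majorant (g := toB6 g R H) blk (D * G) (fun a b => B₀ * g.len a * Real.exp (-(δ * g.dist a b))))
    (hGDs : HasL2Majorant (g := toB6 g R H) blk (G * Ds) (fun a b => B₀ * g.len a * Real.exp (-(δ * g.dist a b))))
    (hQc : HasL2MajorantHom (g := toB6 g R H) blk (fun z : g.Site => z) Qc (fun a b : g.Site => if a = b then κc * wc a else 0))
    (hQcs : HasL2MajorantHom (g := toB6 g R H) (fun z : g.Site => z) blk Qcs (fun a b : g.Site => if a = b then κs * ws a else 0))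
    (h348 : ∀ y y' : g.Site, |Cop (Pi.single y' 1) y| ≤ BC * (g.len y ^ 4)⁻¹ * Real.exp (-(δC * g.dist y y'))) :
    HasL2Majorant (g := toB6 g R H) blk (G * (Qcs ∘ₗ Cop ∘ₗ Qc) * G)
        (fun a b => B9Ineq368PPrime.kappa349 1 B₀ (κs * κc * BC * ΛC) Λ (B6.c1 d δ₀ β) * Real.exp (-(ρ * g.dist a b))) ∧
      HasL2Majorant (g := toB6 g R H) blk (D * (G * (Qcs ∘ₗ Cop ∘ₗ Qc) * G))
        (fun a b => B9Ineq368PPrime.kappa349 1 B₀ (κs * κc * BC * ΛC) Λ (B6.c1 d δ₀ β) * (g.len a)⁻¹ * Real.exp (-(ρ * g.dist a b))) ∧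
      HasL2Majorant (g := toB6 g R H) blk (G * (Qcs ∘ₗ Cop ∘ₗ Qc) * G * Ds)
        (fun a b => B9Ineq368PPrime.kappa349 1 B₀ (κs * κc * BC * ΛC) Λ (B6.c1 d δ₀ β) * (g.len a)⁻¹ * Real.exp (-(ρ * g.dist a b))) ∧
      HasL2Majorant (g := toB6 g R H) blk (D * (G * (Qcs ∘ₗ Cop ∘ₗ Qc) * G) * Ds)
        (fun a b => B9Ineq368PPrime.kappa349 1 B₀ (κs * κc * BC * ΛC) Λ (B6.c1 d δ₀ β) * (g.len a ^ 2)⁻¹ *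
          Real.exp (-(ρ * g.dist a b))) := by
  have hM := hasL2Majorant_QcsCQc_of_readings (R := R) (H := H) blk δ δC αC ΛC κc κs BC wc ws hκc hκs hBC hΛC hws hprod hδC hdnn
    hTC hQc hQcs h348
  have hBM : 0 ≤ κs * κc * BC * ΛC := by positivity
  exact ineq349_l2_sandwich (R := R) (H := H) blk d δ₀ δ α β ρ Λ B₀ (κs * κc * BC * ΛC) hB₀ hBM hΛ hρ hα hβ hδ₀ hr hdnn htri hlen
    h261 hT1 hT2 hT4 hG hDG hGDs hM

end Literature.MathematicalPhysics.QuantumFieldTheory.Balaban1983to89.B9Ineq349L2Readings
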